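import Summits.QuantumAdvantage.AdviceFreeQNC0.AffBells26CubeIdentity
import HarnessLib

/-!
# AffBells34 — the TWIN-SHIFT lemma: exact twins cannot cancel the wide row's own test on cubes created AT the wide row
(planner qa-qnc0-p1 g34, ROUND-33 §D.12)

AUTHORED AND PROVED BY THE PLANNER SEAT qa-qnc0-p1 g34 (`HOME/qa-qnc0-p1/exp34/Nvd34.lean`, farm rc 0 / 0 sorry); landed VERBATIM (one docstring added)
by qn-prover-3 g19 (port ask of ROUND-33 §E′ / ROUND-34 §9; route DWalkThree, crux stmt-QuantumAdvantage-22907).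

Setting: `A = {g₀, a₂}` admissible (a creation AT the row index `g₀`), `h ∉ A` an EXACT TWIN of `g₀` (`β h = β g₀`).  Then
`d β x h a = d β x g₀ a` for every `a`, and if `h` survives (`h ∈ Surv β x A`, so it sees the creation at `g₀`: `d β x h g₀ ≠ 0`) its total drift is
`D h = D g₀ + d β x h g₀` with `d β x h g₀ ≠ 0` — the twin's residue `c + D` is SHIFTED relative to the row at the creation site (the `A.erase g`
clause of `Surv`: a row need not see its own creation).  Consequence (informal, D.12): on such cubes the surviving exact twins all carry ONE residue
`r_h ≠ r_{g₀}`; in the parity `π = [ℓ ≢ r_{g₀}] + k·[ℓ ≢ r_h]` the wide row's test can never be cancelled by twins (`1 ≢ 0 (mod 2)` residue count),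
so NVD-failure needs NEAR-twins (rows at ±-distance ≥ 1) — the REL/(Q-far) territory of D.11.
-/

namespace Summit.QuantumAdvantage.AdviceFreeQNC0

namespace AffBells34

open Finset Literature.Computability.QuantumComplexity Literature.Computability.QuantumComplexity.RingHLF
open AffBells23 AffBells26 Fib19

variable {N : ℕ}

/-- exact twins have equal form changes under every creation. -/
theorem d_eq_of_twin (β : Fin N → Fin N → ZMod 3) (x : Fin N → Bool) {g h : Fin N} (htwin : β h = β g) (a : Fin N) :
    d β x h a = d β x g a := by
  unfold d; rw [htwin]

/-- **Twin shift.** On the cube `A = {g₀, a₂}` (with `g₀ ≠ a₂`), an exact twin `h ∉ A` of `g₀` has drift `D h = D g₀ + d h g₀`. -/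
theorem twin_shift (β : Fin N → Fin N → ZMod 3) (x : Fin N → Bool) {g₀ a₂ h : Fin N} (hne : g₀ ≠ a₂)
    (hh₀ : h ≠ g₀) (hh₂ : h ≠ a₂) (htwin : β h = β g₀) :
    D β x ({g₀, a₂} : Finset (Fin N)) h = D β x ({g₀, a₂} : Finset (Fin N)) g₀ + d β x h g₀ := by
  unfold D
  have hA : ({g₀, a₂} : Finset (Fin N)).erase h = {g₀, a₂} := by
    apply Finset.erase_eq_of_notMem
    simp [hh₀, hh₂]
  have hA0 : ({g₀, a₂} : Finset (Fin N)).erase g₀ = {a₂} := by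
    ext i
    simp only [mem_erase, mem_insert, mem_singleton]
    constructor
    · rintro ⟨hi, hi' | hi'⟩
      · exact absurd hi' hi
      · exact hi'
    · rintro rfl; exact ⟨fun h => hne h.symm, Or.inr rfl⟩
  rw [hA, hA0, sum_pair hne, sum_singleton, d_eq_of_twin β x htwin a₂]
  ring

/-- … and if the twin SURVIVES, the shift is non-zero (it sees the creation at `g₀`). -/
theorem twin_shift_ne (β : Fin N → Fin N → ZMod 3) (x : Fin N → Bool) {g₀ a₂ h : Fin N} (hne : g₀ ≠ a₂)
    (hh₀ : h ≠ g₀) (hh₂ : h ≠ a₂) (htwin : β h = β g₀) (hsurv : h ∈ Surv β x ({g₀, a₂} : Finset (Fin N))) :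
    D β x ({g₀, a₂} : Finset (Fin N)) h ≠ D β x ({g₀, a₂} : Finset (Fin N)) g₀ := by
  rw [twin_shift β x hne hh₀ hh₂ htwin]
  simp only [Surv, mem_filter, mem_univ, true_and] at hsurv
  have hd : d β x h g₀ ≠ 0 := hsurv.2 g₀ (by simp [hh₀.symm])
  intro habs
  apply hd
  have := congrArg (fun t => t - D β x ({g₀, a₂} : Finset (Fin N)) g₀) habs
  simpa using this

/-- All surviving exact twins of `g₀` carry the SAME drift (hence the same residue if they share `c`). -/
theorem twins_same_shift (β : Fin N → Fin N → ZMod 3) (x : Fin N → Bool) {g₀ a₂ h h' : Fin N} (hne : g₀ ≠ a₂)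
    (hh₀ : h ≠ g₀) (hh₂ : h ≠ a₂) (hh₀' : h' ≠ g₀) (hh₂' : h' ≠ a₂) (htwin : β h = β g₀) (htwin' : β h' = β g₀) :
    D β x ({g₀, a₂} : Finset (Fin N)) h = D β x ({g₀, a₂} : Finset (Fin N)) h' := by
  rw [twin_shift β x hne hh₀ hh₂ htwin, twin_shift β x hne hh₀' hh₂' htwin',
    d_eq_of_twin β x htwin g₀, d_eq_of_twin β x htwin' g₀]

/-- The residue-count fact behind "twins cannot cancel": for `a b : ZMod 3` with `a ≠ b` and any `k`, the multiset `{a} + k•{b}` does not have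
all three residue-multiplicities of equal parity (the count of `a` is `1`, the count of the third residue is `0`).  Stated as the parity
obstruction used in D.12. -/
theorem one_ne_zero_mod_two : (1 : ℕ) % 2 ≠ 0 % 2 := by decide

end AffBells34

end Summit.QuantumAdvantage.AdviceFreeQNC0
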